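import Summits.QuantumAdvantage.QuantumAdvantage.Theorems.LinnikCubicClassGroupsDegreeOnePrimesEscapeSplittingTypePNT
import Literature.NumberTheory.LFunctions.LogIntegralStrictMonoProofs
import HarnessLib

/-!
# Splitting types in `S_n`-fields: one-sided Chebotarev bounds free of the exceptional zero

Topic `Summits/QuantumAdvantage/QuantumAdvantage/Theorems`, cell B2b-1 (linnik-cubic), PART A (gen 11);
helper toward the crux `DegreeOnePrimesEscape` (stmt-QuantumAdvantage-11543) of route
`LinnikCubicClassGroups`.  HONEST FRAMING: the value of this file is a THEOREM (kernel-checked, GRH-free,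
Siegel-free, no hypothesis) — NOT summit progress.

`splittingType_PNT_of_symmetric` gives `π_T(x) = δ_T (Li(x) − θ (−1)^{n−|T|} Li(x^{β₁}))(1 ± ε)` with an
unknown `θ ∈ {0,1}`.  Since `0 ≤ Li(x^{β₁}) ≤ Li(x)`, the possible exceptional zero can only DEPRESS the even
classes and INFLATE the odd ones, whence the dichotomy-free bounds (`splittingType_PNT_bounds_of_symmetric`):
for every `S_n`-field `K` of degree `n`, every partition `T` of `n` and every `x ≥ |d_K|^L`,

* `T` an ODD cycle structure (`n − |T|` odd, e.g. the transpositions `{2, 1, …, 1}`):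
  `π_T(x) ≥ (1 − ε) δ_T Li(x)` — odd classes are never deficient;
* `T` an EVEN cycle structure: `π_T(x) ≤ (1 + ε) δ_T Li(x)` — even classes are never superabundant;
* every `T`: `π_T(x) ≤ 2 (1 + ε) δ_T Li(x)` (Brun–Titchmarsh shape with the right density).

Unconditional; `L = L(n, ε)` inexplicit. [cite: LagariasMontgomeryOdlyzko1979, Theorem 1.1]
[cite: ThornerZaman2019, Theorem 1.4]
-/

noncomputable section

open scoped NumberField nonZeroDivisors
open Finset Real Ideal NumberField Set
open Literature.NumberTheory.NumberFields Literature.NumberTheory.LFunctions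
  Literature.NumberTheory.LFunctions.NumberField

namespace Summit.QuantumAdvantage.QuantumAdvantage.Theorems.DegreeOnePrimesEscape

/-- `0 ≤ Li(x^β) ≤ Li(x)` for `x ≥ 9`, `3/4 ≤ β ≤ 1`. -/
theorem offsetLogIntegral_rpow_mem {x β : ℝ} (hx : 9 ≤ x) (hβ : 3 / 4 ≤ β) (hβ1 : β ≤ 1) :
    0 ≤ offsetLogIntegral (x ^ β) ∧ offsetLogIntegral (x ^ β) ≤ offsetLogIntegral x := by
  have hx1 : 1 < x := by linarith
  have hxβ2 : (2 : ℝ) ≤ x ^ β := by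
    have h1 : (9 : ℝ) ^ (3 / 4 : ℝ) ≤ x ^ β :=
      (Real.rpow_le_rpow (by norm_num) hx (by norm_num)).trans (Real.rpow_le_rpow_of_exponent_le hx1.le hβ)
    have h2 : (2 : ℝ) ≤ (9 : ℝ) ^ (3 / 4 : ℝ) := by
      have h3 : (2 : ℝ) ^ (4 : ℝ) ≤ (9 : ℝ) ^ (3 : ℝ) := by norm_num
      have h4 : ((2 : ℝ) ^ (4 : ℝ)) ^ (1 / 4 : ℝ) ≤ ((9 : ℝ) ^ (3 : ℝ)) ^ (1 / 4 : ℝ) :=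
        Real.rpow_le_rpow (by positivity) h3 (by norm_num)
      rw [← Real.rpow_mul (by norm_num), ← Real.rpow_mul (by norm_num)] at h4
      norm_num at h4
      exact h4
    linarith
  refine ⟨?_, ?_⟩
  · have := offsetLogIntegralPow_nonneg 1 hxβ2
    rwa [offsetLogIntegralPow_one] at this
  · have hxβx : x ^ β ≤ x := by
      calc x ^ β ≤ x ^ (1 : ℝ) := Real.rpow_le_rpow_of_exponent_le hx1.le hβ1
        _ = x := Real.rpow_one x
    exact strictMonoOn_offsetLogIntegral_holds.monotoneOn (Set.mem_Ioi.mpr (by linarith)) (Set.mem_Ioi.mpr hx1) hxβx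

set_option maxHeartbeats 4000000 in
/-- **One-sided Chebotarev bounds for splitting types in `S_n`-fields, free of the exceptional zero** (see the
module docstring): odd cycle structures have `π_T(x) ≥ (1−ε) δ_T Li(x)`, even ones `π_T(x) ≤ (1+ε) δ_T Li(x)`,
and always `π_T(x) ≤ 2(1+ε) δ_T Li(x)`, for `x ≥ |d_K|^L`.  Unconditional.
[cite: LagariasMontgomeryOdlyzko1979, Theorem 1.1] [cite: ThornerZaman2019, Theorem 1.4] -/
theorem splittingType_PNT_bounds_of_symmetric (n : ℕ) [NeZero n] (hn : 1 < n) {ε : ℝ} (hε : 0 < ε)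
    (hε1 : ε ≤ 1) :
    ∃ L : ℝ, 0 < L ∧ ∀ (K : Type) [Field K] [NumberField K], Module.finrank ℚ K = n →
      (∀ (M : Type) [Field M] [NumberField M] [IsGalois ℚ M],
        (K →ₐ[ℚ] M) → n.factorial ≤ Module.finrank ℚ M) →
      ∀ T : Multiset ℕ, T.sum = n → (∀ f ∈ T, 0 < f) →
        ∀ x : ℝ, ((NumberField.discr K).natAbs : ℝ) ^ L ≤ x →
          (Odd (n - Multiset.card T) →
            (1 - ε) * (((Finset.univ.filter fun q : Equiv.Perm (Fin n) =>
                q.cycleType + Multiset.replicate (n - q.support.card) 1 = T).card : ℝ) / n.factorial) *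
              offsetLogIntegral x ≤
            ((((Nat.primesLE ⌊x⌋₊).filter (fun p : ℕ => splittingType K p = T)).card : ℕ) : ℝ)) ∧
          (Even (n - Multiset.card T) →
            ((((Nat.primesLE ⌊x⌋₊).filter (fun p : ℕ => splittingType K p = T)).card : ℕ) : ℝ) ≤
            (1 + ε) * (((Finset.univ.filter fun q : Equiv.Perm (Fin n) =>
                q.cycleType + Multiset.replicate (n - q.support.card) 1 = T).card : ℝ) / n.factorial) *
              offsetLogIntegral x) ∧
          ((((Nat.primesLE ⌊x⌋₊).filter (fun p : ℕ => splittingType K p = T)).card : ℕ) : ℝ) ≤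
            2 * (1 + ε) * (((Finset.univ.filter fun q : Equiv.Perm (Fin n) =>
                q.cycleType + Multiset.replicate (n - q.support.card) 1 = T).card : ℝ) / n.factorial) *
              offsetLogIntegral x := by
  obtain ⟨L₀, c, hL₀, hc, hc4, h⟩ := splittingType_PNT_of_symmetric n hn hε hε1
  refine ⟨max L₀ 2, lt_of_lt_of_le hL₀ (le_max_left _ _), fun K _ _ hK hSn T hTsum hTpos x hx => ?_⟩
  obtain ⟨θ, β₁, hθ, hβ₁c, hβ₁1, hT⟩ := h K hK hSn
  set d : ℝ := ((NumberField.discr K).natAbs : ℝ) with hd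
  have hd3 : (3 : ℝ) ≤ d := three_le_natAbs_discr_real K (by rw [hK]; exact hn)
  have hd1 : (1 : ℝ) ≤ d := by linarith
  have hxL₀ : d ^ L₀ ≤ x := (Real.rpow_le_rpow_of_exponent_le hd1 (le_max_left _ _)).trans hx
  have hx9 : (9 : ℝ) ≤ x := by
    have h1 : d ^ (2 : ℝ) ≤ x := (Real.rpow_le_rpow_of_exponent_le hd1 (le_max_right _ _)).trans hx
    have h2 : (3 : ℝ) ^ (2 : ℝ) ≤ d ^ (2 : ℝ) := Real.rpow_le_rpow (by norm_num) hd3 (by norm_num)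
    have h3 : (3 : ℝ) ^ (2 : ℝ) = 9 := by norm_num
    linarith
  have hβ34 : 3 / 4 ≤ β₁ := three_quarters_le_of_window hc hc4 hd3 hβ₁c
  obtain ⟨hLi0, hLi1⟩ := offsetLogIntegral_rpow_mem hx9 hβ34 hβ₁1.le
  have hmain := hT T hTsum hTpos x hxL₀
  set δ : ℝ := ((Finset.univ.filter fun q : Equiv.Perm (Fin n) =>
      q.cycleType + Multiset.replicate (n - q.support.card) 1 = T).card : ℝ) / n.factorial with hδ
  have hδ0 : 0 ≤ δ := by positivity
  set πT : ℝ := ((((Nat.primesLE ⌊x⌋₊).filter (fun p : ℕ => splittingType K p = T)).card : ℕ) : ℝ) with hπT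
  set M : ℝ := offsetLogIntegral x - θ * (-1) ^ (n - Multiset.card T) * offsetLogIntegral (x ^ β₁) with hM
  have hθ01 : 0 ≤ θ ∧ θ ≤ 1 := by rcases hθ with h0 | h1 <;> subst_vars <;> norm_num
  have hab := abs_sub_le_iff.mp hmain
  -- `M ≤ Li(x) + Li(x^β₁) ≤ 2 Li(x)` always
  have hMle : M ≤ offsetLogIntegral x + offsetLogIntegral (x ^ β₁) := by
    rw [hM]
    have : -(θ * (-1 : ℝ) ^ (n - Multiset.card T) * offsetLogIntegral (x ^ β₁)) ≤ offsetLogIntegral (x ^ β₁) := by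
      rcases Nat.even_or_odd (n - Multiset.card T) with he | ho
      · rw [he.neg_one_pow]; nlinarith [hθ01.1, hθ01.2]
      · rw [ho.neg_one_pow]; nlinarith [hθ01.1, hθ01.2]
    linarith
  refine ⟨fun hodd => ?_, fun heven => ?_, ?_⟩
  · -- odd: `M = Li x + θ Li(x^β₁) ≥ Li x`
    have hMge : offsetLogIntegral x ≤ M := by
      rw [hM, hodd.neg_one_pow]; nlinarith [hθ01.1]
    have h1 : (1 - ε) * (δ * M) ≤ πT := by nlinarith [hab.2]
    have h2 : (1 - ε) * (δ * offsetLogIntegral x) ≤ (1 - ε) * (δ * M) :=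
      mul_le_mul_of_nonneg_left (mul_le_mul_of_nonneg_left hMge hδ0) (by linarith)
    linarith
  · -- even: `M = Li x − θ Li(x^β₁) ≤ Li x`
    have hMle' : M ≤ offsetLogIntegral x := by
      rw [hM, heven.neg_one_pow]; nlinarith [hθ01.1]
    have h1 : πT ≤ (1 + ε) * (δ * M) := by nlinarith [hab.1]
    have h2 : (1 + ε) * (δ * M) ≤ (1 + ε) * (δ * offsetLogIntegral x) :=
      mul_le_mul_of_nonneg_left (mul_le_mul_of_nonneg_left hMle' hδ0) (by linarith)
    linarith
  · have h1 : πT ≤ (1 + ε) * (δ * M) := by nlinarith [hab.1]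
    have h2 : (1 + ε) * (δ * M) ≤ (1 + ε) * (δ * (2 * offsetLogIntegral x)) :=
      mul_le_mul_of_nonneg_left (mul_le_mul_of_nonneg_left (by linarith) hδ0) (by linarith)
    linarith

end Summit.QuantumAdvantage.QuantumAdvantage.Theorems.DegreeOnePrimesEscape

end
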